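import Mathlib
import Summits.HodgeConjecture.FermatCycles.HodgeFermatTheoremKRB

/-!
# THEOREM KR6 — part 3: `kr6_of_W` (`HodgeFermat/TheoremKR.lean`; HF-G28)

Tree copy (part 3 of 3) of the module `HodgeFermat/TheoremKR.lean` of the sibling cell's standalone package
`run/shared/lean/pub/pub-hodgefermat/lean/HodgeFermat/` (793 lines, sha256 `b514baea4362d10e…`), source lines 532–793 (§§7–9: the shared configuration with unit wings — LEMMA W, THEOREM KR6 `kr6_of_W`, `kr6Multiset_of_W`, `d6_of_kr6`, kernel sanity checks).
Filed by cell `pub-hfermat`, seat prover-1 gen-3, on the COORDINATOR KEEPER RULING of 2026-08-25 (gem sweep H1: take the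
off-gate kernel theorem `thmFstar` through the gate) — here THEOREM F* of `tables/DPRIME-THEOREM.md` §9 IN FULL, i.e.
PROPOSITION D′(3N) and the descent (`HodgeFermat/PropDPrimeNFinal.lean`, GATE HF-G34), the last off-gate form of THEOREM F*
(its first two forms, `DecodingFinal.thmFstar` = F* at the prime levels and `ThmFstarNFinal.thmFstar` = F*(3N), landed on
2026-08-25 as `HodgeFermatThmFstar.lean` / `HodgeFermatThmFstarN.lean`, seats prover-1 gen-0 / gen-2); this file is one link of
the import closure of `PropDPrimeNFinal.propDprime` (the sibling's KR-free chain: THEOREM L, COROLLARY M, THEOREM D6,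
THEOREM U⁺, THEOREM KR6, THEOREM Z3U) on top of those landed chains.  The source module is the sibling's hub-checked module of
record (pub-hodgefermat `CERT.md` l.927, GATE HF-G28); its declarations are copied VERBATIM.
Deviations from the source module, exhaustively: the `import` lines (tree modules `Summits.HodgeConjecture.FermatCycles.
HodgeFermat*` instead of `HodgeFermat.*`); this module docstring; the `set_option`/namespace/`open` preamble (source l.50–56) and part 1's four re-binding `open` lines are repeated at the top because the module is split. The module docstring is quoted in full in part 1.
Every other line — in particular every declaration's statement and proof — is byte-identical to the source.
HONEST FRAMING: explicit algebraic cycles for specific Hodge classes on Fermat/Delsarte varieties; residual open instances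
listed; no claim on general Hodge.  (This file is arithmetic of CM types / finite combinatorics / analytic number theory
of the sibling's KR-free programme; it claims nothing about cycles.)
-/

set_option autoImplicit false

namespace HodgeFermat.KRFree.TheoremKR

open Finset HodgeFermat.KRFree HodgeFermat.KRFree.LemmaN HodgeFermat.KRFree.LemmaO HodgeFermat.KRFree.TheoremL
  HodgeFermat.KRFree.Bridge HodgeFermat.KRFree.TheoremD6 HodgeFermat.KRFree.PropL7c HodgeFermat.KRFree.TheoremU
open HodgeFermat.KRFree.TheoremUEq (Perm3 zmod_multiset_eq)

open HodgeFermat.KRFree.Decoding renaming st_symm → sameType_symm, st_trans → sameType_trans, st_swap → sameType_swap, st_rot → sameType_rot, unit_mul_not_dvd → not_dvd_unit_mul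
open HodgeFermat.KRFree.Decoding (rsum_swap rsum_rot)
open HodgeFermat.KRFree.TheoremZ3U renaming not_dvd_cofactor' → not_dvd_cofactor, rsum_const₃ → rsum_const_of_dvd
open HodgeFermat.KRFree.PropZ5 (mul_mod_mod)

/-! ## The shared configuration with unit wings: LEMMA W -/

/-- the weight `wt` of a pair with EQUAL first residues `A = A'` vanishes off the eight wing residues -/
lemma wt_cancel_of_ne {N A B C B' C' x : ℕ} (h2 : x ≠ B) (h3 : x ≠ C) (h5 : x ≠ B') (h6 : x ≠ C')
    (h8 : x ≠ N - B) (h9 : x ≠ N - C) (h11 : x ≠ N - B') (h12 : x ≠ N - C') :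
    wt N A B C A B' C' x = 0 := by
  unfold wt
  rw [δ_ne h2, δ_ne h3, δ_ne h5, δ_ne h6, δ_ne h8, δ_ne h9, δ_ne h11, δ_ne h12]
  ring

/-- **The shared configuration with unit wings, from LEMMA W at `N`.**  Two triples `(a, b, c)`, `(a', b', c')` of
an odd level `N > 1` with the same CM type, `a ≡ a' (mod N)` NOT divisible by `N` (but not necessarily a unit) and
the four wings `b, c, b', c'` units: then `b ≡ b'` or `b ≡ c'`.  [LEMMA W applied to `w = 1_T − 1_{T'} − 1_{−T} +
1_{−T'}`, whose `±a`-terms cancel; `w(b) ≥ 1` unless `b ∈ {b', c'}`, because `b ≡ −b` is excluded by oddness and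
`b ≡ −c` by `N ∤ a`.] -/
theorem shared_wings (N a b c a' b' c' : ℕ) (hW : LemmaW N) (h1N : 1 < N) (h2 : ¬ 2 ∣ N)
    (hs : N ∣ a + b + c) (hs' : N ∣ a' + b' + c') (hsh : a ≡ a' [MOD N]) (ha : ¬ N ∣ a)
    (hb : Nat.Coprime b N) (hc : Nat.Coprime c N) (hb' : Nat.Coprime b' N) (hc' : Nat.Coprime c' N)
    (hT : SameType N (a, b, c) (a', b', c')) :
    b ≡ b' [MOD N] ∨ b ≡ c' [MOD N] := by
  have hN : 0 < N := by omega
  have hsh' : a % N = a' % N := hsh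
  -- the residues (A = A')
  obtain ⟨A, hA⟩ : ∃ A, A = a % N := ⟨_, rfl⟩
  obtain ⟨B, hB⟩ : ∃ B, B = b % N := ⟨_, rfl⟩
  obtain ⟨C, hC⟩ : ∃ C, C = c % N := ⟨_, rfl⟩
  obtain ⟨B', hB'⟩ : ∃ B', B' = b' % N := ⟨_, rfl⟩
  obtain ⟨C', hC'⟩ : ∃ C', C' = c' % N := ⟨_, rfl⟩
  have hA' : A = a' % N := hA.trans hsh'
  have lA : A < N := hA ▸ Nat.mod_lt _ hN
  have lB : B < N := hB ▸ Nat.mod_lt _ hN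
  have lC : C < N := hC ▸ Nat.mod_lt _ hN
  have lB' : B' < N := hB' ▸ Nat.mod_lt _ hN
  have lC' : C' < N := hC' ▸ Nat.mod_lt _ hN
  have pA : 0 < A := by
    rw [hA]; exact Nat.pos_of_ne_zero (fun h => ha (Nat.dvd_of_mod_eq_zero h))
  have cB : Nat.Coprime B N := hB ▸ coprime_mod hb
  have cC : Nat.Coprime C N := hC ▸ coprime_mod hc
  have cB' : Nat.Coprime B' N := hB' ▸ coprime_mod hb'
  have cC' : Nat.Coprime C' N := hC' ▸ coprime_mod hc'
  have pB := pos_of_coprime h1N cB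
  have pC := pos_of_coprime h1N cC
  have pB' := pos_of_coprime h1N cB'
  have pC' := pos_of_coprime h1N cC'
  have nB := coprime_sub lB.le cB
  have nC := coprime_sub lC.le cC
  have nB' := coprime_sub lB'.le cB'
  have nC' := coprime_sub lC'.le cC'
  -- LEMMA W applied to the odd weight with A' = A
  have hw0 : ∀ x, wt N A B C A B' C' x = 0 := by
    refine hW (wt N A B C A B' C') ?_ ?_ ?_ ?_ ?_
    · -- zero off [0, N)
      intro x hx
      apply wt_eq_zero_of_ne <;> omega
    · -- zero off the units: the ±A terms cancel, the eight wing residues are units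
      intro x hx
      have key : ∀ y, Nat.Coprime y N → x ≠ y := fun y hy e => hx (e ▸ hy)
      exact wt_cancel_of_ne (key B cB) (key C cC) (key B' cB') (key C' cC') (key _ nB) (key _ nC)
        (key _ nB') (key _ nC')
    · -- odd
      intro x hx0 hxN
      exact wt_odd N A B C A B' C' x hx0 hxN
    · -- at most 8-point support
      have hsub : (range N).filter (fun x => wt N A B C A B' C' x ≠ 0) ⊆
          ([B, C, B', C', N - B, N - C, N - B', N - C'] : List ℕ).toFinset := by
        intro x hx
        rw [mem_filter] at hx
        rw [List.mem_toFinset]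
        by_contra hnot
        simp only [List.mem_cons, not_or, List.mem_nil_iff, not_false_eq_true, and_true] at hnot
        obtain ⟨n2, n3, n5, n6, n8, n9, n11, n12⟩ := hnot
        exact hx.2 (wt_cancel_of_ne n2 n3 n5 n6 n8 n9 n11 n12)
      calc ((range N).filter (fun x => wt N A B C A B' C' x ≠ 0)).card
          ≤ (([B, C, B', C', N - B, N - C, N - B', N - C'] : List ℕ).toFinset).card := card_le_card hsub
        _ ≤ ([B, C, B', C', N - B, N - C, N - B', N - C'] : List ℕ).length := List.toFinset_card_le _
        _ ≤ 12 := by norm_num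
    · -- the residue transform vanishes at units: carries of T and T' agree, ⟨ta⟩ = ⟨ta'⟩, ⟨t(N − y)⟩ = N − ⟨ty⟩
      intro t ht
      rw [transform_wt N A B C A B' C' t lA.le lB.le lC.le lA.le lB'.le lC'.le]
      have dB : ¬ N ∣ t * B := not_dvd_of_coprime h1N (Nat.Coprime.mul_left ht cB)
      have dC : ¬ N ∣ t * C := not_dvd_of_coprime h1N (Nat.Coprime.mul_left ht cC)
      have dB' : ¬ N ∣ t * B' := not_dvd_of_coprime h1N (Nat.Coprime.mul_left ht cB')
      have dC' : ¬ N ∣ t * C' := not_dvd_of_coprime h1N (Nat.Coprime.mul_left ht cC')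
      have e2 := neg_res hN lB.le dB
      have e3 := neg_res hN lC.le dC
      have e5 := neg_res hN lB'.le dB'
      have e6 := neg_res hN lC'.le dC'
      have hcN : ¬ N ∣ t * c := not_dvd_of_coprime h1N (Nat.Coprime.mul_left ht hc)
      have hcN' : ¬ N ∣ t * c' := not_dvd_of_coprime h1N (Nat.Coprime.mul_left ht hc')
      have hR := rsum_eq_of_sameType hN hs hs' hcN hcN' hT ht
      simp only [rsum] at hR
      have r1 : t * A % N = t * a % N := by rw [hA]; exact mul_mod_mod t a N
      have r2 : t * B % N = t * b % N := by rw [hB]; exact mul_mod_mod t b N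
      have r3 : t * C % N = t * c % N := by rw [hC]; exact mul_mod_mod t c N
      have r4 : t * A % N = t * a' % N := by rw [hA']; exact mul_mod_mod t a' N
      have r5 : t * B' % N = t * b' % N := by rw [hB']; exact mul_mod_mod t b' N
      have r6 : t * C' % N = t * c' % N := by rw [hC']; exact mul_mod_mod t c' N
      omega
  -- evaluate the weight at B
  have hwB := hw0 B
  by_contra hcon
  simp only [not_or] at hcon
  obtain ⟨m1, m2⟩ := hcon
  have ne1 : B ≠ B' := fun e => m1 (by unfold Nat.ModEq; rw [← hB, ← hB', e])
  have ne2 : B ≠ C' := fun e => m2 (by unfold Nat.ModEq; rw [← hB, ← hC', e])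
  have ne3 : B ≠ N - B := fun e => h2 ⟨B, by omega⟩
  have ne4 : B ≠ N - C := by
    intro e
    have hbc : N ∣ b + c := by
      apply Nat.dvd_of_mod_eq_zero
      rw [Nat.add_mod, ← hB, ← hC, show B + C = N by omega, Nat.mod_self]
    have hs2 : N ∣ b + c + a := by rwa [show b + c + a = a + b + c by ring]
    exact ha ((Nat.dvd_add_right hbc).mp hs2)
  unfold wt at hwB
  rw [δ_self, δ_ne ne1, δ_ne ne2, δ_ne ne3, δ_ne ne4] at hwB
  have g1 := δ_nonneg B A
  have g2 := δ_nonneg B C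
  have g3 := δ_nonneg B (N - A)
  have g4 := δ_nonneg B (N - B')
  have g5 := δ_nonneg B (N - C')
  omega

/-- **The shared configuration is contradictory** (given LEMMA W at the level): jointly primitive pair, `a ≡ a'`,
the wing `b` congruent to neither `b'` nor `c'`, the wing `c` likewise. -/
theorem shared_false {N a b c a' b' c' : ℕ} (hW : LemmaW N) (S : PSetting N (a, b, c) (a', b', c'))
    (hsh : a ≡ a' [MOD N]) (hw₁ : ¬ b ≡ b' [MOD N]) (hw₂ : ¬ b ≡ c' [MOD N]) (hw₃ : ¬ c ≡ b' [MOD N])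
    (hw₄ : ¬ c ≡ c' [MOD N]) : False := by
  have hb : Nat.Coprime b N := wing_coprime S hsh hw₁ hw₂ hw₃ hw₄
  have hc : Nat.Coprime c N := wing_coprime S.rot.swap12 hsh hw₃ hw₄ hw₁ hw₂
  have hb' : Nat.Coprime b' N :=
    wing_coprime S.symm hsh.symm (fun e => hw₁ e.symm) (fun e => hw₃ e.symm) (fun e => hw₂ e.symm)
      (fun e => hw₄ e.symm)
  have hc' : Nat.Coprime c' N :=
    wing_coprime S.symm.rot.swap12 hsh.symm (fun e => hw₂ e.symm) (fun e => hw₄ e.symm) (fun e => hw₁ e.symm)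
      (fun e => hw₃ e.symm)
  rcases shared_wings N a b c a' b' c' hW S.one_lt S.two S.hsum S.hsum' hsh S.nz₁ hb hc hb' hc' S.same
    with h | h
  · exact hw₁ h
  · exact hw₂ h

/-! ## THEOREM KR6 -/

/-- a pair with a common first entry: `T'` is a permutation of `T` (given LEMMA W at the level) -/
theorem key {N a b c a' b' c' : ℕ} (hW : LemmaW N) (S : PSetting N (a, b, c) (a', b', c'))
    (hsh : a ≡ a' [MOD N]) : Perm3 (a % N) (b % N) (c % N) (a' % N) (b' % N) (c' % N) := by
  have hS : a + b + c ≡ a' + b' + c' [MOD N] :=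
    ((Nat.modEq_zero_iff_dvd).mpr S.hsum).trans ((Nat.modEq_zero_iff_dvd).mpr S.hsum').symm
  by_cases h1 : b ≡ b' [MOD N]
  · have hcc : c ≡ c' [MOD N] := Nat.ModEq.add_left_cancel (hsh.add h1) hS
    exact Or.inl ⟨hsh, h1, hcc⟩
  · by_cases h2 : b ≡ c' [MOD N]
    · have hS' : a + b + c ≡ a' + c' + b' [MOD N] := by rwa [Nat.add_right_comm a' b' c'] at hS
      have hcc : c ≡ b' [MOD N] := Nat.ModEq.add_left_cancel (hsh.add h2) hS'
      exact Or.inr (Or.inl ⟨hsh, h2, hcc⟩)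
    · have h3 : ¬ c ≡ b' [MOD N] := by
        intro h3
        have hS' : a + c + b ≡ a' + b' + c' [MOD N] := by rwa [Nat.add_right_comm a b c] at hS
        exact h2 (Nat.ModEq.add_left_cancel (hsh.add h3) hS')
      have h4 : ¬ c ≡ c' [MOD N] := by
        intro h4
        have hS' : a + c + b ≡ a' + c' + b' [MOD N] := by
          rwa [Nat.add_right_comm a b c, Nat.add_right_comm a' b' c'] at hS
        exact h1 (Nat.ModEq.add_left_cancel (hsh.add h4) hS')
      exact (shared_false hW S hsh h1 h2 h3 h4).elim

/-- THEOREM KR6, jointly primitive case, given THEOREM D6 and LEMMA W at the level: the disjoint case is D6;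
otherwise some entry of `T` is congruent to some entry of `T'` — permute both to the front and apply `key`. -/
theorem kr6_primitive (hD : D6) {N a b c a' b' c' : ℕ} (hW : LemmaW N)
    (S : PSetting N (a, b, c) (a', b', c')) :
    Perm3 (a % N) (b % N) (c % N) (a' % N) (b' % N) (c' % N) := by
  by_cases hd : Disj N (a, b, c) (a', b', c')
  · exact (hD N a b c a' b' c' S.sq S.two S.three S.hsum S.hsum' S.nz₁ S.nz₂ S.nz₃ S.nz₁' S.nz₂' S.nz₃'
      hd S.same).elim
  · simp only [Disj, NotIn, not_and_or, not_not] at hd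
    rcases hd with (h | h | h) | (h | h | h) | (h | h | h)
    · exact key hW S h
    · exact perm3_swap12' (key hW S.swap12' h)
    · exact perm3_rot' (perm3_rot' (key hW S.rot' h))
    · exact perm3_swap12 (key hW S.swap12 h)
    · exact perm3_swap12 (perm3_swap12' (key hW S.swap12.swap12' h))
    · exact perm3_swap12 (perm3_rot' (perm3_rot' (key hW S.swap12.rot' h)))
    · exact perm3_rot (perm3_rot (key hW S.rot h))
    · exact perm3_rot (perm3_rot (perm3_swap12' (key hW S.rot.swap12' h)))
    · exact perm3_rot (perm3_rot (perm3_rot' (perm3_rot' (key hW S.rot.rot' h))))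

/-- **THEOREM KR6 from LEMMA W at every squarefree level `N > 1` prime to 6** (`HypW`).  The common divisor of the
level and the six entries is divided out by strong induction on the level (`sameType_descend`; the conclusion lifts
back because `⟨q x⟩_{qN₁} = q ⟨x⟩_{N₁}`), then `kr6_primitive` applies, THEOREM D6 being `theoremD6_of_W`. -/
theorem kr6_of_W (hW : HypW) : KR6 := by
  have hD : D6 := theoremD6_of_W hW
  intro N
  refine Nat.strong_induction_on
    (p := fun N => ∀ a b c a' b' c' : ℕ, Squarefree N → ¬ 2 ∣ N → ¬ 3 ∣ N →
      N ∣ a + b + c → N ∣ a' + b' + c' →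
      ¬ N ∣ a → ¬ N ∣ b → ¬ N ∣ c → ¬ N ∣ a' → ¬ N ∣ b' → ¬ N ∣ c' →
      SameType N (a, b, c) (a', b', c') → Perm3 (a % N) (b % N) (c % N) (a' % N) (b' % N) (c' % N)) N ?_
  intro N ih a b c a' b' c' hsq h2 h3 hs hs' ha hb hc ha' hb' hc' hH
  by_cases hjp : JP N (a, b, c) (a', b', c')
  · have S : PSetting N (a, b, c) (a', b', c') := ⟨hsq, h2, h3, hs, hs', ha, hb, hc, ha', hb', hc', hjp, hH⟩
    exact kr6_primitive hD (hW N S.one_lt hsq h2 h3) S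
  · -- a prime `q` divides the level and all six entries: descend to level `N / q`
    simp only [JP, not_forall, not_false_eq_true, and_true, exists_prop] at hjp
    obtain ⟨q, hq, hqN, h1, h2', h3', h4, h5, h6⟩ := hjp
    have hN0 : 0 < N := Nat.pos_of_ne_zero (fun h => by subst h; exact not_squarefree_zero hsq)
    obtain ⟨N₁, rfl⟩ := hqN
    obtain ⟨a₁, rfl⟩ := h1
    obtain ⟨b₁, rfl⟩ := h2'
    obtain ⟨c₁, rfl⟩ := h3'
    obtain ⟨a₁', rfl⟩ := h4
    obtain ⟨b₁', rfl⟩ := h5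
    obtain ⟨c₁', rfl⟩ := h6
    have hN₁ : 0 < N₁ := pos_right hN0
    have hlt : N₁ < q * N₁ := by
      have h2q := hq.two_le
      nlinarith
    have hs₁ : N₁ ∣ a₁ + b₁ + c₁ := by
      have h' : q * a₁ + q * b₁ + q * c₁ = q * (a₁ + b₁ + c₁) := by ring
      rw [h'] at hs
      exact Nat.dvd_of_mul_dvd_mul_left hq.pos hs
    have hs₁' : N₁ ∣ a₁' + b₁' + c₁' := by
      have h' : q * a₁' + q * b₁' + q * c₁' = q * (a₁' + b₁' + c₁') := by ring
      rw [h'] at hs'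
      exact Nat.dvd_of_mul_dvd_mul_left hq.pos hs'
    have hP := ih N₁ hlt a₁ b₁ c₁ a₁' b₁' c₁' (Squarefree.squarefree_of_dvd (dvd_mul_left N₁ q) hsq)
      (fun h => h2 (Dvd.dvd.mul_left h q)) (fun h => h3 (Dvd.dvd.mul_left h q)) hs₁ hs₁'
      (fun h => ha (Nat.mul_dvd_mul_left q h)) (fun h => hb (Nat.mul_dvd_mul_left q h))
      (fun h => hc (Nat.mul_dvd_mul_left q h)) (fun h => ha' (Nat.mul_dvd_mul_left q h))
      (fun h => hb' (Nat.mul_dvd_mul_left q h)) (fun h => hc' (Nat.mul_dvd_mul_left q h))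
      (sameType_descend hq.pos hN₁ hH)
    have e : ∀ x, q * x % (q * N₁) = q * (x % N₁) := fun x => Nat.mul_mod_mul_left q x N₁
    simp only [e]
    exact hP.map (fun x => q * x)

/-- THEOREM KR6 as an equality of multisets `{a, b, c} = {a', b', c'}` in `ℤ/N`. -/
theorem kr6Multiset_of_W (hW : HypW) : KR6Multiset :=
  fun N a b c a' b' c' hsq h2 h3 hs hs' ha hb hc ha' hb' hc' hH =>
    zmod_multiset_eq (kr6_of_W hW N a b c a' b' c' hsq h2 h3 hs hs' ha hb hc ha' hb' hc' hH)

/-- THEOREM D6 is the disjoint case of THEOREM KR6. -/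
theorem d6_of_kr6 (h : KR6) : D6 := by
  intro N a b c a' b' c' hsq h2 h3 hs hs' ha hb hc ha' hb' hc' hd hH
  rcases h N a b c a' b' c' hsq h2 h3 hs hs' ha hb hc ha' hb' hc' hH with
    ⟨e, -, -⟩ | ⟨e, -, -⟩ | ⟨e, -, -⟩ | ⟨e, -, -⟩ | ⟨e, -, -⟩ | ⟨e, -, -⟩
  · exact hd.1.1 e
  · exact hd.1.1 e
  · exact hd.1.2.1 e
  · exact hd.1.2.1 e
  · exact hd.1.2.2 e
  · exact hd.1.2.2 e

/-! ## Kernel sanity checks -/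

/-- `Perm3` computes: `(1, 2, 32)` and `(32, 36, 2)` agree as unordered triples mod `35`; `(1, 2, 32)`, `(1, 4, 30)` do not -/
example : Perm3 (1 % 35) (2 % 35) (32 % 35) (32 % 35) (36 % 35) (2 % 35) := by unfold Perm3; decide
example : ¬ Perm3 (1 % 35) (2 % 35) (32 % 35) (1 % 35) (4 % 35) (30 % 35) := by unfold Perm3; decide

/-- the weight with equal first residues: at `N = 35`, `T = (5, 1, 29)`, `T' = (5, 2, 28)` (a shared NON-unit entry
`5`), `w = wt 35 5 1 29 5 2 28` vanishes at `5` and `30` (the `±a`-terms cancel) and `w(1) = 1` -/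
example : wt 35 5 1 29 5 2 28 5 = 0 ∧ wt 35 5 1 29 5 2 28 30 = 0 ∧ wt 35 5 1 29 5 2 28 1 = 1 := by
  unfold wt δ; decide

end HodgeFermat.KRFree.TheoremKR
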